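import Literature.Topology.FourManifolds.MorseRearrangementProofs
import HarnessLib

/-!
# Milnor 1965, Thm. 4.1 with one set of critical points, on a slab, keeping the gradient-like
# field: the reparametrisation `θ ∘ f` of `MorseRearrangementProofs.lean` is gradient-like

Topic `Literature/Topology/FourManifolds` (fact seat
`provefact-Literature.Topology.FourManifolds.Cobordism.Milnor1965_exists_isolatedPair_of_basis`;
this file discharges, as a theorem with the same statement, the named fact
`Literature.Topology.FourManifolds.Cobordism.Milnor1965_rearrangement_slab_oneLevel` of
`HCobordismBasisTheorem.lean` — Thm. 4.1 with one set of critical points, applied to a slab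
`f⁻¹[a₀, a₁]` of a cobordism, keeping the field).  Milnor, *Lectures on the h-cobordism theorem*
(1965), Thm. 4.1 (PDF p. 22 of the held copy): *there exists a new Morse function `g` such that
(a) `ξ` is a gradient-like vector field for `g`, (b) the critical points of `g` are still `p`,
`p'`, and `g(p) = a`, `g(p') = a'`, (c) `g` agrees with `f` near `V₀ ∪ V₁` and equals `f` plus a
constant in some neighborhood of `p` and in some neighborhood of `p'`*; proof (PDF pp. 22–23):
`g = G(f, μ̄)`; with the second set of critical points empty this is `g = G(f, 0)`, a
reparametrisation of the values of `f`.

`MorseRearrangementProofs.lean` (`§ LevelShift`) constructs the reparametrisation `θ : ℝ → ℝ`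
(smooth, `θ' > 0`, the identity off the open slab, a translation near the critical level) and
proves that `θ ∘ f` is a Morse function on the cobordism with the same critical points and
indices (`Literature.Topology.FourManifolds.Cobordism.Milnor1965_move_level_holds`).  Here, in addition:
(a) every gradient-like field for `f` is gradient-like for `θ ∘ f` — `ξ(θ ∘ f) = θ'(f) ξ(f) > 0`
off the critical points, and near each critical point `θ ∘ f = f +` const, so that Milnor's
normal form of Def. 3.1 (2) persists (`Literature.Topology.FourManifolds.IsGradientLike.of_locallyEq_add_const`); (c)
applying the construction on a slightly smaller open slab, `θ ∘ f = f` on a *neighbourhood* of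
`{f ∉ (a₀, a₁)}`.

## Main results

* `Literature.Topology.FourManifolds.IsGradientLike.of_locallyEq_add_const` — Def. 3.1 is local and invariant under
  adding constants to the function near the critical points;
* `Literature.Topology.FourManifolds.Cobordism.IsMorseFunction.exists_levelShift` — Thm. 4.1 with one set of critical
  points on a slab, keeping `ξ` (the statement of
  `Literature.Topology.FourManifolds.Cobordism.Milnor1965_rearrangement_slab_oneLevel`, proved).

## References

* J. Milnor, *Lectures on the h-cobordism theorem*, notes by L. Siebenmann and J. Sondow,
  Princeton Mathematical Notes (1965): Def. 3.1 (PDF pp. 11–12), Thm. 4.1 and its proof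
  (PDF pp. 22–23), 4.2 (PDF p. 23), applied as on PDF p. 53.  [MilnorHCobordism1965]
-/

open Set Function Filter
open scoped Manifold Topology ContDiff

noncomputable section

namespace Literature.Topology.FourManifolds

universe u

/-! ### Def. 3.1 under adding constants near the critical points -/

section GradientLike

variable {m : ℕ} {H : Type*} [TopologicalSpace H] {J : ModelWithCorners ℝ (EuclideanSpace ℝ (Fin m)) H}
  {M : Type*} [TopologicalSpace M] [ChartedSpace H M]
  {f : M → ℝ} {ξ : Π x : M, TangentSpace J x}

/-- **Milnor 1965, Def. 3.1 is local and invariant under adding constants: a pair `(f', ξ')`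
with `ξ'(f') > 0` at the non-critical points of `f'`, which near every critical point of `f'`
agrees with `(f + const, ξ)` for a gradient-like pair `(f, ξ)`, is gradient-like** (Milnor's
coordinate neighbourhood of 3.1 (2) for `(f, ξ)` at such a point, cut down to where the pairs
agree, is one for `(f', ξ')`: the normal form `f = f(p) - |x⃗|² + |y⃗|²` survives the addition of
a constant).  This is what makes the new function of Thm. 4.1, which *"equals `f` plus a
constant in some neighborhood of `p`"*, again carry `ξ` as a gradient-like field.
[cite: MilnorHCobordism1965, Def. 3.1 (PDF pp. 11–12); Thm. 4.1 (a), (c) (PDF p. 22)] -/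
theorem IsGradientLike.of_locallyEq_add_const (h : IsGradientLike J f ξ) {f' : M → ℝ}
    {ξ' : Π x : M, TangentSpace J x}
    (hpos : ∀ p, ¬ IsMCriticalPt J f' p → 0 < mlineDeriv J f' p (ξ' p))
    (hloc : ∀ p, IsMCriticalPt J f' p →
      ∃ U : Set M, IsOpen U ∧ p ∈ U ∧ ∃ C : ℝ, (∀ q ∈ U, f' q = f q + C) ∧ ∀ q ∈ U, ξ' q = ξ q) :
    IsGradientLike J f' ξ' where
  mlineDeriv_pos := hpos
  exists_chart p hp := by
    obtain ⟨U, hUo, hpU, C, hfU, hξU⟩ := hloc p hp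
    have hev : f' =ᶠ[𝓝 p] fun y => f y + C := eventuallyEq_of_mem (hUo.mem_nhds hpU) hfU
    have hp' : IsMCriticalPt J f p := (isMCriticalPt_congr_of_eventuallyEq_add_const hev).1 hp
    obtain ⟨φ, hφ, k, hpφ, hfφ, hξφ⟩ := h.exists_chart p hp'
    have hsrc : (φ.restr U).source = φ.source ∩ U := φ.restr_source' U hUo
    have hcoe : ((φ.restr U).extend J : M → EuclideanSpace ℝ (Fin m)) = φ.extend J := by
      funext x
      simp only [OpenPartialHomeomorph.extend_coe, Function.comp_apply,
        OpenPartialHomeomorph.restr_apply]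
    refine ⟨φ.restr U, restr_mem_maximalAtlas (contDiffGroupoid ∞ J) hφ hUo, k, ?_, ?_, ?_⟩
    · rw [hsrc]; exact ⟨hpφ, hpU⟩
    · intro q hq
      rw [hsrc] at hq
      rw [hcoe, hfU q hq.2, hfU p hpU, hfφ q hq.1]
      ring
    · intro q hq
      rw [hsrc] at hq
      rw [hcoe, hξU q hq.2]
      exact hξφ q hq.1

end GradientLike

/-! ### Thm. 4.1 with one set of critical points on a slab, keeping the field -/

namespace Cobordism

variable {n : ℕ} {M N : Type u} [TopologicalSpace M] [T2Space M] [SecondCountableTopology M]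
  [ChartedSpace (EuclideanSpace ℝ (Fin n)) M] [IsManifold (𝓡 n) ∞ M] [CompactSpace M]
  [TopologicalSpace N] [T2Space N] [SecondCountableTopology N] [ChartedSpace (EuclideanSpace ℝ (Fin n)) N]
  [IsManifold (𝓡 n) ∞ N] [CompactSpace N]

omit [T2Space M] [SecondCountableTopology M] [IsManifold (𝓡 n) ∞ M] [CompactSpace M] [T2Space N]
  [SecondCountableTopology N] [IsManifold (𝓡 n) ∞ N] [CompactSpace N] in
/-- **Milnor 1965, Thm. 4.1 with one set of critical points, applied to a slab of a cobordism,
keeping the gradient-like field** (the statement of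
`Literature.Topology.FourManifolds.Cobordism.Milnor1965_rearrangement_slab_oneLevel`, proved).  For a Morse function `f`
on the cobordism `c`, a smooth gradient-like field `ξ`, a slab `0 ≤ a₀ < a₁ ≤ 1` all of whose
critical points belong to a set `P` of critical points on the level `b ∈ (a₀, a₁)`, and
`a ∈ (a₀, a₁)`: with `θ` the reparametrisation of `LevelShift.exists_move` on a slightly
smaller open slab (`θ' > 0`, `θ = id` off it, `θ = · + (a - b)` near `b`), `g = θ ∘ f` is a Morse
function on `c` with `ξ` gradient-like (`ξ(g) = θ'(f) ξ(f)`, and `g = f +` const near the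
critical points), the same critical set, `g = a` on `P`, `g = f` near `{f ∉ (a₀, a₁)}`, `g`
mapping `f⁻¹(a₀, a₁)` into `(a₀, a₁)`, and `g = f + (a - b)` near `P`.
[cite: MilnorHCobordism1965, Thm. 4.1 (PDF p. 22) and its proof (PDF pp. 22–23), case of one set of critical points; applied as on PDF p. 53] -/
theorem IsMorseFunction.exists_levelShift {c : Cobordism n M N} {f : c.W → ℝ}
    (hf : c.IsMorseFunction f)
    (ξ : Cₛ^∞⟮𝓡∂ (n + 1); EuclideanSpace ℝ (Fin (n + 1)), (TangentSpace (𝓡∂ (n + 1)) : c.W → Type)⟯)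
    (hξ : IsGradientLike (𝓡∂ (n + 1)) f ξ) {a₀ a₁ : ℝ} (ha₀ : 0 ≤ a₀) (_ : a₀ < a₁)
    (ha₁ : a₁ ≤ 1) {P : Set c.W} (_ : P ⊆ criticalSet (𝓡∂ (n + 1)) f)
    (hcrit : ∀ z ∈ criticalSet (𝓡∂ (n + 1)) f, f z ∈ Icc a₀ a₁ → z ∈ P)
    {b : ℝ} (hb : b ∈ Ioo a₀ a₁) (hPb : ∀ p ∈ P, f p = b) {a : ℝ} (ha : a ∈ Ioo a₀ a₁) :
    ∃ g : c.W → ℝ, c.IsMorseFunction g ∧ IsGradientLike (𝓡∂ (n + 1)) g ξ ∧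
      criticalSet (𝓡∂ (n + 1)) g = criticalSet (𝓡∂ (n + 1)) f ∧ (∀ p ∈ P, g p = a) ∧
      (∀ᶠ z in 𝓝ˢ {z | f z ∉ Ioo a₀ a₁}, g z = f z) ∧
      (∀ z, f z ∈ Ioo a₀ a₁ → g z ∈ Ioo a₀ a₁) ∧
      (∀ p ∈ P, ∀ᶠ z in 𝓝 p, g z = f z + (a - b)) := by
  -- a slightly smaller open slab `(a₀', a₁')` containing `b` and `a`
  set a₀' : ℝ := (a₀ + min b a) / 2 with ha₀'d
  set a₁' : ℝ := (max b a + a₁) / 2 with ha₁'d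
  have h₀ : a₀ < a₀' := by
    rw [ha₀'d]; have := lt_min hb.1 ha.1; linarith
  have h₀b : a₀' < b := by
    rw [ha₀'d]; have := min_le_left b a; have := lt_min hb.1 ha.1; linarith
  have h₀a : a₀' < a := by
    rw [ha₀'d]; have := min_le_right b a; have := lt_min hb.1 ha.1; linarith
  have h₁ : a₁' < a₁ := by
    rw [ha₁'d]; have := max_lt hb.2 ha.2; linarith
  have hb₁ : b < a₁' := by
    rw [ha₁'d]; have := le_max_left b a; have := max_lt hb.2 ha.2; linarith
  have ha₁' : a < a₁' := by
    rw [ha₁'d]; have := le_max_right b a; have := max_lt hb.2 ha.2; linarith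
  obtain ⟨θ, hθ, hθd, hθfar, hθnear⟩ := LevelShift.exists_move h₀b hb₁ (a' := a) ⟨h₀a, ha₁'⟩
  have hθfar' : ∀ x, x ∉ Ioo a₀ a₁ → θ x = x := fun x hx =>
    hθfar x fun h => hx ⟨h₀.trans h.1, h.2.trans h₁⟩
  have hmono : StrictMono θ := strictMono_of_deriv_pos hθd
  have hθ0 : θ 0 = 0 := hθfar' 0 fun h => absurd h.1 (not_lt.2 ha₀)
  have hθ1 : θ 1 = 1 := hθfar' 1 fun h => absurd h.2 (not_lt.2 ha₁)
  have hfs : ContMDiff (𝓡∂ (n + 1)) 𝓘(ℝ, ℝ) ∞ f := hf.1.contMDiff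
  set g : c.W → ℝ := θ ∘ f with hg
  have hgs : ContMDiff (𝓡∂ (n + 1)) 𝓘(ℝ, ℝ) ∞ g := hθ.comp_contMDiff hfs
  -- the same critical points
  have hcritiff : ∀ z, IsMCriticalPt (𝓡∂ (n + 1)) g z ↔ IsMCriticalPt (𝓡∂ (n + 1)) f z :=
    fun z => isMCriticalPt_comp_iff_of_hasDerivAt ((hθ.differentiable (by simp)) _).hasDerivAt
      (hθd _).ne' (hfs.mdifferentiableAt (by simp))
  have hcritset : criticalSet (𝓡∂ (n + 1)) g = criticalSet (𝓡∂ (n + 1)) f :=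
    Set.ext fun z => hcritiff z
  -- near each critical point, `g = f + const`
  have hnearP : ∀ p ∈ P, ∀ᶠ z in 𝓝 p, g z = f z + (a - b) := by
    intro p hp
    have hfc : ContinuousAt f p := hfs.continuous.continuousAt
    have : ∀ᶠ x in 𝓝 (f p), θ x = x + (a - b) := by rw [hPb p hp]; exact hθnear
    filter_upwards [hfc.eventually this] with y hy
    exact hy
  have hloc : ∀ z ∈ criticalSet (𝓡∂ (n + 1)) f, ∃ C, g =ᶠ[𝓝 z] fun y => f y + C := by
    intro z hz
    have hfc : ContinuousAt f z := hfs.continuous.continuousAt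
    by_cases hzP : z ∈ P
    · exact ⟨a - b, hnearP z hzP⟩
    · refine ⟨0, ?_⟩
      have hnot : f z ∉ Icc a₀ a₁ := fun h => hzP (hcrit z hz h)
      have hopen : ∀ᶠ x in 𝓝 (f z), x ∉ Ioo a₀ a₁ := by
        rcases not_and_or.1 (fun h => hnot h) with h | h
        · filter_upwards [Iio_mem_nhds (not_le.1 h)] with x hx hx'
          exact absurd (hx'.1.le) (not_le.2 hx)
        · filter_upwards [Ioi_mem_nhds (not_le.1 h)] with x hx hx'
          exact absurd (hx'.2.le) (not_le.2 hx)
      filter_upwards [hfc.eventually hopen] with y hy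
      show θ (f y) = f y + 0
      rw [add_zero, hθfar' _ hy]
  have hMorse : IsMorse (𝓡∂ (n + 1)) g := by
    refine ⟨hgs, fun z hz => ?_⟩
    have hzf : IsMCriticalPt (𝓡∂ (n + 1)) f z := (hcritiff z).1 hz
    obtain ⟨C, hC⟩ := hloc z hzf
    rw [mhessian_congr_of_eventuallyEq_add_const hC]
    exact hf.1.nondegenerate hzf
  have hgM : c.IsMorseFunction g := by
    refine ⟨hMorse, fun x => ?_, fun y => ?_, fun z hz hzc => ?_, fun z hz => ?_⟩
    · show θ (f (c.inl x)) = 0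
      rw [hf.2.1 x, hθ0]
    · show θ (f (c.inr y)) = 1
      rw [hf.2.2.1 y, hθ1]
    · exact hf.2.2.2.1 z hz ((hcritiff z).1 hzc)
    · obtain ⟨hz0, hz1⟩ := hf.2.2.2.2 z hz
      exact ⟨hθ0 ▸ hmono hz0, hθ1 ▸ hmono hz1⟩
  -- `ξ` is gradient-like for `g`
  have hGL : IsGradientLike (𝓡∂ (n + 1)) g ξ := by
    refine hξ.of_locallyEq_add_const (fun z hz => ?_) (fun z hz => ?_)
    · -- `ξ(g) = θ'(f) ξ(f) > 0` off the critical set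
      have hfz : MDifferentiableAt (𝓡∂ (n + 1)) 𝓘(ℝ, ℝ) f z := hfs.mdifferentiableAt (by simp)
      have hθz : HasDerivAt θ (deriv θ (f z)) (f z) := ((hθ.differentiable (by simp)) _).hasDerivAt
      have hchain : HasMFDerivAt (𝓡∂ (n + 1)) 𝓘(ℝ, ℝ) g z
          ((ContinuousLinearMap.smulRight (1 : ℝ →L[ℝ] ℝ) (deriv θ (f z))).comp
            (mfderiv (𝓡∂ (n + 1)) 𝓘(ℝ, ℝ) f z)) :=
        HasMFDerivAt.comp z hθz.hasFDerivAt.hasMFDerivAt hfz.hasMFDerivAt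
      have hval : mlineDeriv (𝓡∂ (n + 1)) g z (ξ z) =
          mlineDeriv (𝓡∂ (n + 1)) f z (ξ z) * deriv θ (f z) := by
        rw [mlineDeriv_def, hchain.mfderiv]
        rfl
      rw [hval]
      exact mul_pos (hξ.mlineDeriv_pos z fun h => hz ((hcritiff z).2 h)) (hθd _)
    · -- near a critical point `g = f + const` and the field is unchanged
      have hzf : IsMCriticalPt (𝓡∂ (n + 1)) f z := (hcritiff z).1 hz
      obtain ⟨C, hC⟩ := hloc z hzf
      obtain ⟨U, hU, hUo, hzU⟩ := mem_nhds_iff.1 hC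
      exact ⟨U, hUo, hzU, C, fun q hq => hU hq, fun q _ => rfl⟩
  refine ⟨g, hgM, hGL, hcritset, fun p hp => ?_, ?_, fun z hz => ?_, hnearP⟩
  · show θ (f p) = a
    rw [hPb p hp, hθnear.self_of_nhds]
    ring
  · -- `g = f` on the open neighbourhood `{f < a₀'} ∪ {f > a₁'}` of `{f ∉ (a₀, a₁)}`
    have hO : IsOpen {z : c.W | f z < a₀' ∨ a₁' < f z} :=
      (isOpen_lt hfs.continuous continuous_const).union (isOpen_lt continuous_const hfs.continuous)
    have hsub : {z : c.W | f z ∉ Ioo a₀ a₁} ⊆ {z : c.W | f z < a₀' ∨ a₁' < f z} := by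
      intro z hz
      rcases not_and_or.1 (fun h => hz h) with h | h
      · exact Or.inl ((not_lt.1 h).trans_lt h₀)
      · exact Or.inr (h₁.trans_le (not_lt.1 h))
    filter_upwards [hO.mem_nhdsSet.2 hsub] with z hz
    show θ (f z) = f z
    refine hθfar (f z) fun h => ?_
    rcases hz with hz | hz
    · exact lt_asymm hz h.1
    · exact lt_asymm hz h.2
  · show θ (f z) ∈ Ioo a₀ a₁
    exact LevelShift.move_mem_Ioo hθd hθfar' hz

end Cobordism

end Literature.Topology.FourManifolds
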